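import Summits.BirchSwinnertonDyer.BirchSwinnertonDyer.Theorems.GenusKolyvaginAtTwoEquivariantKolyvaginExactAtTwoReciprocityRat
import Summits.BirchSwinnertonDyer.BirchSwinnertonDyer.Theorems.ByReductionTypeAtTwoRankOneAtTwoOffBigImageOddLocalEngineRegularLemma53Rat
import HarnessLib

/-!
# Route `ByReductionTypeAtTwo`, crux `RankOneAtTwoOffBigImageOddLocal` (stmt-BirchSwinnertonDyer-23716), line
# `refined_kolyvagin_tamagawa_shift_at_two`, stub `stub_sigmaShiftPosDisc`: McCallum's Lemma 5.3 + Prop. 2.2 over `ℚ_ℓ` at `2` MODULO the regular tame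
# shape (Gross (7.6)), at a **REGULAR** Kolyvagin prime — no sign condition on `Δ`

Lead prover `prover-cruxlead-stmt-BirchSwinnertonDyer-23716-g4` (2026-08-28; `--supports` the crux, closes nothing).  Eighth regular-engine CONSUMER:
the sibling's `GenusExact.FrobeniusCriterion.lemma_5_3_rat_two_of_tameShape` (file `…ReciprocityRat`, seat `bsd-line-gk2-p3`) with its (`Δ < 0`,
`FrobEqFrobInfty`) input replaced by the regular datum of `…EngineRegularLemma53Rat` (p664226): Poitou–Tate over `ℚ` (PROVED in the tree,
`poitouTate_sum_localTatePairing_eq_zero_holds`) makes the local cup product of `s_v`, `d_v` vanish; the displayed local shape `hShape` (Gross (7.6) in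
qualitative form for a Frobenius acting on `E[q]` as an INVOLUTION — the guard «`F = c₀` on `E[q]`» of the sibling replaced by «`F² = 1` on `E[q]`»)
turns that into the reciprocity value; `lemma_5_3_descent_of_reciprocity_rat_two_regular` concludes.  The archimedean hypothesis `hdinf` is carried
verbatim (vacuous on `Δ < 0`; on `Δ > 0` it is the located non-port, memo `Cruxes/…/SigmaShiftPosDiscArchimedean.md`).

THEOREMS ONLY (no definition, no named fact, no `sorry`, standard axioms).  BSD is not proved by any of this; the crux is not proved; the stub is not proved.

References: [McCallumLMS1991] §5 Lemma 5.3, §2 Prop. 2.2; [GrossLMS1991] §7 (7.6), Prop. 8.2; [MilneADT2006] I Thm. 4.10.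
-/

set_option autoImplicit false
set_option linter.dupNamespace false -- tree convention: `Summit.BirchSwinnertonDyer.BirchSwinnertonDyer.Theorems` (summit = sub-problem)

noncomputable section

open scoped Classical Pointwise

namespace Summit.BirchSwinnertonDyer.BirchSwinnertonDyer.Theorems.OffBigImageOddLocalAtTwo.Engine

open WeierstrassCurve NumberField IsDedekindDomain Field
open Literature.NumberTheory.EllipticCurves Literature.NumberTheory.GaloisRepresentations
open Literature.NumberTheory.GaloisCohomology
open Summit.BirchSwinnertonDyer.Rank1Residual.X11b
open Summit.BirchSwinnertonDyer.BirchSwinnertonDyer.Theorems.GenusExact.FrobeniusCriterion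

variable (W : WeierstrassCurve ℚ) [W.IsElliptic]

/-- **McCallum's Lemma 5.3 with Prop. 2.2 over `ℚ_ℓ` at `p = 2`, MODULO Gross (7.6), at a REGULAR Kolyvagin prime (any sign of `Δ`).**  Setting of
`lemma_5_3_descent_of_reciprocity_rat_two_regular` (`q = 2^M`, `ℓ` odd good at `v` with `q ∣ ℓ + 1`, a Frobenius at some `𝔓₀ ∣ ℓ` acting on `E[q]` as an
involution moving a `2`-torsion point), with `s ∈ Sel^{(q)}(E/ℚ)` and `d ∈ H¹(ℚ, E[q])` Selmer at the finite places `≠ v` and at `∞` but `2^a d` NOT Selmer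
at `v`.  HYPOTHESIS `hShape` (displayed, not proved): for the Weil pairing `e` on `E[q]`, IF the local cup product of `s_v`, `d_v` vanishes THEN
`e([s, F], [d, σ]) = 1` for every prime `𝔓 ∣ v`, every arithmetic Frobenius `F` at `𝔓` acting on `E[q]` as an INVOLUTION and every `σ ∈ I_𝔓` (Gross (7.6),
qualitative form, regular local action).  CONCLUSION: **`2^{M−1−a}·s_v = 0`**. [cite: McCallumLMS1991, §5 Lemma 5.3, §2 Prop. 2.2]
[cite: GrossLMS1991, §7 (7.6), Prop. 8.2] -/
theorem lemma_5_3_rat_two_of_tameShape_regular {M : ℕ} (hM : 1 ≤ M) {q : ℕ} (hq : q = 2 ^ M)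
    [NeZero q] {ℓ : ℕ} (hℓ : ℓ.Prime) (hℓ2 : ℓ ≠ 2) {v : HeightOneSpectrum (𝓞 ℚ)}
    (hℓv : (ℓ : 𝓞 ℚ) ∈ v.asIdeal) (hqℓ : q ∣ ℓ + 1) (hgood : W.HasGoodReductionAt v)
    (hreg : ∃ (𝔓₀ : Ideal (absIntegers (𝓞 ℚ) ℚ)) (h : absoluteGaloisGroup ℚ), 𝔓₀ ∈ v.primesAbove ∧
      IsArithFrobAt (𝓞 ℚ) h 𝔓₀ ∧ (∀ X : geomTorsion W (q : ℤ), h • h • X = X) ∧ ∃ u : geomTorsion W 2, h • u ≠ u)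
    (hShape : ∀ (e : geomTorsion W q → geomTorsion W q → AlgebraicClosure ℚ)
      (hμ : ∀ S T, e S T ^ q = 1) (hadd₁ : ∀ S₁ S₂ T, e (S₁ + S₂) T = e S₁ T * e S₂ T)
      (hadd₂ : ∀ S T₁ T₂, e S (T₁ + T₂) = e S T₁ * e S T₂)
      (hgal : ∀ (σ : absoluteGaloisGroup ℚ) (S T : geomTorsion W q), σ • e S T = e (σ • S) (σ • T)),
      (∀ T, e T T = 1) → (∀ T, (∀ S, e S T = 1) → T = 0) →
      ∀ (s d : galH1Torsion W (q : ℤ)), s ∈ selmerLocalKer W (v.adicCompletion ℚ) (q : ℤ) →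
      (haveI := absoluteGaloisGroup_compactSpace (v.adicCompletion ℚ)
       ((weilContPairing W q e hμ hadd₁ hadd₂ hgal).restrict
          (absGaloisRestrict ℚ (v.adicCompletion ℚ))).cupProduct
          (galoisCohomology.localization (W.torsionGaloisModule ((q : ℕ) : ℤ)) (Sum.inr v) 1 s)
          (galoisCohomology.localization (W.torsionGaloisModule ((q : ℕ) : ℤ)) (Sum.inr v) 1 d) = 0) →
      ∀ 𝔓 ∈ v.primesAbove, ∀ F : absoluteGaloisGroup ℚ, IsArithFrobAt (𝓞 ℚ) F 𝔓 →
        (∀ X : geomTorsion W (q : ℤ), F • F • X = X) →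
        ∀ σ ∈ 𝔓.inertia (absoluteGaloisGroup ℚ), e (h1Eval W (q : ℤ) s F) (h1Eval W (q : ℤ) d σ) = 1)
    {s : galH1Torsion W (q : ℤ)} (hs : s ∈ selmerGroup W (q : ℤ))
    {d : galH1Torsion W (q : ℤ)}
    (hdfin : ∀ w : HeightOneSpectrum (𝓞 ℚ), w ≠ v → d ∈ selmerLocalKer W (w.adicCompletion ℚ) (q : ℤ))
    (hdinf : ∀ w : InfinitePlace ℚ, d ∈ selmerLocalKer W w.Completion (q : ℤ))
    {a : ℕ} (hdv : ((2 : ℤ) ^ a) • d ∉ selmerLocalKer W (v.adicCompletion ℚ) (q : ℤ)) :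
    ((2 : ℤ) ^ (M - 1 - a)) • s ∈ W.torsionLocalKer (v.adicCompletion ℚ) (q : ℤ) := by
  have hq2 : 2 ≤ q := by
    rw [hq]
    calc 2 = 2 ^ 1 := (pow_one 2).symm
      _ ≤ 2 ^ M := Nat.pow_le_pow_right (by norm_num) hM
  have hq0 : q ≠ 0 := by omega
  have hqQ : ((q : ℕ) : ℚ) ≠ 0 := Nat.cast_ne_zero.mpr hq0
  -- the Weil pairing on `E[q]`
  obtain ⟨e, hμ, hadd₁, hadd₂, halt, hnondeg, hgal⟩ := W.exists_weilPairing_holds q hq2 hqQ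
  -- the local Selmer condition of `s` at `v`
  have hsv : s ∈ selmerLocalKer W (v.adicCompletion ℚ) (q : ℤ) := ((mem_selmerGroup_iff W _ s).mp hs).1 v
  -- §1 of the sibling file: the local cup product at `v` vanishes (Poitou–Tate over `ℚ`, PROVED)
  have hcup := cupProduct_localization_eq_zero_of_selmer W (poitouTate_sum_localTatePairing_eq_zero_holds ℚ)
    e hμ hadd₁ hadd₂ halt hgal v hs hdfin hdinf
  -- the reciprocity value in additive form, via the displayed local shape
  have hR : ∀ 𝔓 ∈ v.primesAbove, ∀ F : absoluteGaloisGroup ℚ, IsArithFrobAt (𝓞 ℚ) F 𝔓 →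
      (∀ X : geomTorsion W (q : ℤ), F • F • X = X) →
      ∀ σ ∈ 𝔓.inertia (absoluteGaloisGroup ℚ),
        weilPairingHom W q e hμ hadd₁ hadd₂ (h1Eval W (q : ℤ) s F) (h1Eval W (q : ℤ) d σ) = 0 := by
    intro 𝔓 h𝔓 F hF hFF σ hσ
    rw [TameCup.weilPairingHom_eq_zero_iff]
    exact hShape e hμ hadd₁ hadd₂ hgal halt hnondeg s d hsv hcup 𝔓 h𝔓 F hF hFF σ hσ
  exact lemma_5_3_descent_of_reciprocity_rat_two_regular W hM hq hℓ hℓ2 hℓv hqℓ hgood hreg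
    (weilPairingHom W q e hμ hadd₁ hadd₂) (weilPairingHom_self W q e hμ hadd₁ hadd₂ halt)
    (TameCup.weilPairingHom_left_nondeg W q e hμ hadd₁ hadd₂ halt hnondeg) hdv hsv hR

end Summit.BirchSwinnertonDyer.BirchSwinnertonDyer.Theorems.OffBigImageOddLocalAtTwo.Engine

end
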